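/-
Copyright: the b2b-balaban cell (near-miss cell 7), T⁴-continuum fan-out; row NE7b ROUND-2 swarm, seat
t4-ne7b-formalise-leaf-05 gen 2 (row S6g′ binding of `t4/b2b-balaban-t4-ne7b-p1/LEAVES-NE7b.md`, owner's ruling R-OWNER-22-12 (2)).
Released under the licence of the surrounding project.
-/
import Summits.QuantumFields.BalabanUV.T4Continuum.Support.HistoryJoinsBudget
import Summits.QuantumFields.BalabanUV.T4Continuum.Support.HistorySiblingEntropy

/-!
# History joins, part 7: the RANK-FREE budget — the sibling entropy as the displayed residual (row S6g′ × (e)∕(f))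

Summits-side support leaf of the T⁴-continuum cell (rung (B)+1 on a FINITE torus only; NOT infinite volume, NOT the
mass gap, NOT the Clay statement; NOT a proof of the spine estimate NE7b).  Row NE7b, route «COUNT»; row S6g′, the
binding, continued from `HistoryJoinsBudget` (part 6), now against leaf-10 gen 3's EXACT split
`HistorySiblingEntropy.classes_cost_le` (row S6g′(e), p213070): no rank, no fibre hypothesis — the residual is the
join's SIBLING ENTROPY `log((r−1)! ∕ ∏_g k_g!)`, whose class-linear bound is row S6g′(f).  [folklore] real arithmetic
and well-founded recursion over the lineage's own carrier; nothing is quoted from print, nothing printed is asserted,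
no `[cite:]` tag, no `Prop` fact of Bałaban's.

WHAT.  `ent` (the top join's sibling entropy = `logMultinomial univ csize`), **`jfac_le_exp_ent : jfac ≤ exp(2(r−1) +
Σ_j M t (part j) + ent)·∏_{i≠h} NZ_i`**, `ENT` (Σ over the joins), `budgetE := exp(2·mrg + MS + ENT)·NZP`,
**`jW_le_budgetE`** (every shape tree), **`card_S_le_budgetE`**.  With part 6's `NZP_le_pow` and `MS_eq_sum_joins`
(+ leaf-02 gen 3's `HistoryZoneMassTotal`) every term except `ENT` is class-linear by name.

HONEST SCOPE.  `ENT` displayed (row S6g′(f), leaf-10 gen 3).  NE7b NOT proved.  HONEST DEPENDENCY (cell): continuum YM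
on T⁴ ⇐ BetaPertH ∧ nine spine estimates (0/9 proved); BetaPertH ⇐ (D1) ∧ (D4) ∧ CAP+tail.  This file changes none
of it.
-/

open Finset
open Literature.MathematicalPhysics.QuantumFieldTheory.Balaban1983to89
open T4PersistenceDictionary T4PartnerMultiplicity T4BranchingRecordsGas
open Summit.QuantumFields.BalabanUV.T4Continuum.HistoryJoins
open Summit.QuantumFields.BalabanUV.T4Continuum.HistoryJoinsAdm
open Summit.QuantumFields.BalabanUV.T4Continuum.HistoryJoinsCount
open Summit.QuantumFields.BalabanUV.T4Continuum.HistoryJoinsTotal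
open Summit.QuantumFields.BalabanUV.T4Continuum.HistoryJoinsClass
open Summit.QuantumFields.BalabanUV.T4Continuum.HistoryJoinsBudget
open Summit.QuantumFields.BalabanUV.T4Continuum.HistorySiblingEntropy

namespace Summit.QuantumFields.BalabanUV.T4Continuum.HistoryJoinsEntropyBudget

noncomputable section

open scoped Classical

variable {ε : Type*} (st : ε → ℕ) (M : ℕ → Gen ε → ℕ) (ext : ℕ → Gen ε → ℝ) (NZ : ℝ → ℕ → ℕ → ℕ)

/-! ## §1 The per-join factor against the exact split; §2 the budget -/

/-- **THE SIBLING ENTROPY OF THE TOP JOIN**: `log((r−1)! ∕ ∏_classes k_g!)` — `logMultinomial` of the class sizes.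
[folklore] -/
def ent (X Y : Gen ε) (e : ε) : ℝ := logMultinomial (univ : Finset (Fin (npart st (Gen.merge X Y e)))) (csize st X Y e)

/-- the sibling entropy is nonnegative [folklore] -/
theorem ent_nonneg (X Y : Gen ε) (e : ε) : 0 ≤ ent st X Y e := logMultinomial_nonneg _ _

/-- **THE PER-JOIN FACTOR, RANK-FREE** (`HistorySiblingEntropy.classes_cost_le`):
`jfac ≤ exp(2(r−1) + Σ_j M t (part j) + ent)·∏_{i≠h} NZ_i` — no rank, no fibre hypothesis; the residual is the join's
sibling entropy. [folklore] -/
theorem jfac_le_exp_ent (X Y : Gen ε) (e : ε) :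
    jfac st M ext NZ X Y e ≤
      Real.exp (2 * ((npart st (Gen.merge X Y e) : ℝ) - 1) + (∑ j, (M (st e) (part st (Gen.merge X Y e) j).2 : ℝ)) +
          ent st X Y e) *
        ∏ i : {i // i ≠ hostIdx st X Y e},
          (NZ (ext (st e) (part st (Gen.merge X Y e) i.1).2) (st e) (part st _ i.1).2.rootStep : ℝ) := by
  set n := npart st (Gen.merge X Y e)
  set Z : ℝ := ∑ j, (M (st e) (part st (Gen.merge X Y e) j).2 : ℝ)
  have hZ0 : 0 ≤ Z := sum_nonneg fun _ _ => Nat.cast_nonneg _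
  have hNZ0 : 0 ≤ ∏ i : {i // i ≠ hostIdx st X Y e},
      (NZ (ext (st e) (part st (Gen.merge X Y e) i.1).2) (st e) (part st _ i.1).2.rootStep : ℝ) :=
    prod_nonneg fun _ _ => Nat.cast_nonneg _
  have hn : 2 ≤ n := by
    have h1 := one_le_length_clusterParts st (st e) X
    have h2 := one_le_length_clusterParts st (st e) Y
    have : (jparts st (Gen.merge X Y e)).length = (clusterParts st (st e) X).length + (clusterParts st (st e) Y).length := by
      rw [jparts_merge, List.length_append, List.length_map, List.length_map]
    simp only [n, npart, this]; omega
  have hsym := symFac_pos st X Y e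
  have hjfac : jfac st M ext NZ X Y e = Z ^ (n - 1) / symFac st X Y e *
      ∏ i : {i // i ≠ hostIdx st X Y e},
        (NZ (ext (st e) (part st (Gen.merge X Y e) i.1).2) (st e) (part st _ i.1).2.rootStep : ℝ) := by
    unfold jfac; ring
  rw [hjfac]
  refine mul_le_mul_of_nonneg_right ?_ hNZ0
  rw [div_le_iff₀ hsym]
  rcases hZ0.eq_or_lt with hz | hz
  · -- no mass: the power vanishes
    rw [← hz, zero_pow (by omega)]
    exact mul_nonneg (Real.exp_pos _).le hsym.le
  · -- `Z^{r−1} ∕ symFac = exp(Σ_j (c_j log Z − log c_j!)) ≤ exp(2(r−1) + Z + ent)`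
    have hcost := classes_cost_le (univ : Finset (Fin n)) (csize st X Y e) hz.le
    have hlogsym : Real.log (symFac st X Y e) = ∑ j, Real.log ((csize st X Y e j).factorial : ℝ) := by
      rw [symFac_eq_prod, Real.log_prod (hf := fun j _ => by exact_mod_cast (Nat.factorial_pos _).ne')]
    have hpow : Z ^ (n - 1) = Real.exp (((n - 1 : ℕ) : ℝ) * Real.log Z) := by
      rw [Real.exp_nat_mul, Real.exp_log hz]
    have hexp : Z ^ (n - 1) = Real.exp (∑ j, ((csize st X Y e j : ℝ) * Real.log Z -
        Real.log ((csize st X Y e j).factorial : ℝ))) * symFac st X Y e := by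
      rw [sum_sub_distrib, ← sum_mul, ← Nat.cast_sum, sum_csize, ← hlogsym, Real.exp_sub, Real.exp_log hsym, hpow,
        div_mul_cancel₀ _ hsym.ne']
    rw [hexp]
    refine mul_le_mul_of_nonneg_right (Real.exp_le_exp.2 ?_) hsym.le
    have hcast : ((n - 1 : ℕ) : ℝ) = (n : ℝ) - 1 := by rw [Nat.cast_sub (by omega), Nat.cast_one]
    calc ∑ j, ((csize st X Y e j : ℝ) * Real.log Z - Real.log ((csize st X Y e j).factorial : ℝ))
        ≤ 2 * ∑ j, (csize st X Y e j : ℝ) + Z + logMultinomial univ (csize st X Y e) := hcost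
      _ = 2 * ((n : ℝ) - 1) + Z + ent st X Y e := by
          rw [← Nat.cast_sum, sum_csize, hcast]; rfl

/-- the sibling entropies over all joins [folklore] -/
def ENT : Gen ε → ℝ
  | Gen.born _ _ => 0
  | Gen.renew G _ _ => ENT G
  | Gen.merge X Y e => ent st X Y e + ∑ i : Fin (npart st (Gen.merge X Y e)), ENT (part st _ i).2
termination_by G => gsize G
decreasing_by
  · simp [gsize]
  · exact gsize_lt_of_mem_jparts st _ _ (part_mem st _ i)

/-- **THE RANK-FREE BUDGET**: `exp(2·mrg + MS + ENT)·NZP`. [folklore] -/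
def budgetE (G : Gen ε) : ℝ := Real.exp (2 * mrg st G + MS st M G + ENT st G) * NZP st ext NZ G

/-- **`jW ≤ budgetE`** for EVERY shape tree — no rank, no fibre display; the residual is `ENT`, the sum of the joins'
sibling entropies (row S6g′(f)'s target). [folklore] -/
theorem jW_le_budgetE : ∀ G : Gen ε, jW st M ext NZ G ≤ budgetE st M ext NZ G
  | Gen.born b j => by simp [budgetE, jW_born, mrg, MS, ENT, NZP]
  | Gen.renew G e h => by
      rw [jW_renew, budgetE, mrg, MS, ENT, NZP]
      exact jW_le_budgetE G
  | Gen.merge X Y e => by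
      have ih : ∀ i : Fin (npart st (Gen.merge X Y e)),
          jW st M ext NZ (part st _ i).2 ≤ budgetE st M ext NZ (part st _ i).2 :=
        fun i => jW_le_budgetE (part st _ i).2
      have hj := jfac_le_exp_ent st M ext NZ X Y e
      rw [jW_merge, budgetE, mrg, MS, ENT, NZP]
      have h1 : jfac st M ext NZ X Y e * ∏ i, jW st M ext NZ (part st (Gen.merge X Y e) i).2 ≤
          (Real.exp (2 * ((npart st (Gen.merge X Y e) : ℝ) - 1) +
              (∑ j, (M (st e) (part st (Gen.merge X Y e) j).2 : ℝ)) + ent st X Y e) *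
            ∏ i : {i // i ≠ hostIdx st X Y e},
              (NZ (ext (st e) (part st (Gen.merge X Y e) i.1).2) (st e) (part st _ i.1).2.rootStep : ℝ)) *
          ∏ i, budgetE st M ext NZ (part st (Gen.merge X Y e) i).2 :=
        mul_le_mul hj (prod_le_prod (fun i _ => jW_nonneg st M ext NZ _) fun i _ => ih i)
          (prod_nonneg fun i _ => jW_nonneg st M ext NZ _)
          (mul_nonneg (Real.exp_pos _).le (prod_nonneg fun _ _ => Nat.cast_nonneg _))
      refine h1.trans (le_of_eq ?_)
      simp only [budgetE]
      rw [prod_mul_distrib, ← Real.exp_sum, sum_add_distrib, sum_add_distrib, ← mul_sum, mul_mul_mul_comm,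
        ← Real.exp_add]
      congr 1
      congr 1
      ring
termination_by G => gsize G
decreasing_by
  · simp [gsize]
  · exact gsize_lt_of_mem_jparts st _ _ (part_mem st _ i)

/-- **THE COUNT AGAINST THE RANK-FREE BUDGET**: `#S G z ≤ exp(2·mrg + MS + ENT)·NZP`. [folklore] -/
theorem card_S_le_budgetE {γ β R : Type*} [DecidableEq β] [LinearOrder R] [Fintype γ] {D : ℕ}
    (zone : ℕ → Gen ε → (Addr D → γ) → Finset β) (ρ : (Addr D → γ) → R) (c₀ : γ)
    (near : β → ℕ → γ → ℕ → ℝ → Prop)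
    (hcard : ∀ (t : ℕ) (Z : Gen ε) (p : Addr D → γ), p ∈ Sany zone ρ c₀ st Z → (zone t Z p).card ≤ M t Z)
    (hloc : ∀ (t : ℕ) (Z : Gen ε) (p : Addr D → γ) (u : β), p ∈ Sany zone ρ c₀ st Z → u ∈ zone t Z p →
      near u t (evalA c₀ p (rootAddr Z)) Z.rootStep (ext t Z))
    (hNZ : ∀ (u : β) (t s : ℕ) (r : ℝ), (univ.filter fun y : γ => near u t y s r).card ≤ NZ r t s)
    (G : Gen ε) (z : γ) : ((S zone ρ c₀ st G z).card : ℝ) ≤ budgetE st M ext NZ G :=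
  (card_S_le_jW zone ρ c₀ st M ext NZ near hcard hloc hNZ G z).trans (jW_le_budgetE st M ext NZ G)

end

end Summit.QuantumFields.BalabanUV.T4Continuum.HistoryJoinsEntropyBudget
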